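import Summits.Ventures.HSemireg.Pad4TowerFCCoreSeam
import Summits.Ventures.HSemireg.Pad4TowerDelta2Window

/-!
# Venture HSemireg — PAD-4 on 𝔅(μ₄): the FC-CORE PARITY SEAM — the two-phase seam `Pad4TowerFCCoreSeam` holds VERBATIM for ALL FOUR
# PHASES once its pattern is read as the PARITY pattern and its charge product as the SIGNED charge product; hence LEMMA FC-CORE §1b
# (COROLLARY 1b) for every weighted 𝔅(μ₄) configuration: (A1) + μ ≠ 0 ⇒ fully charged classes in ≥ 8 parity patterns, of weights
# {0, 2, 4} (even core) or {1, 3} (odd core); on a Δ²-closed support ≥ 16 fully charged classes; a support whose fully charged classes all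
# have parity weight in {0, 4} is (A1)-infeasible with μ ≠ 0 for EVERY multiplicity vector (RESULT 14 ∕ 15 (3); the ◇₈ no-Ψ witness's death)

HONEST FRAMING. Lean index of the computation cell `pub-hsemireg` (S4-PUSH, H2 door PAD-4), typed by the Ventures-side typer
`hodge-lit-semireg-typer-2` (g5; line of record stmt-HodgeConjecture-18881 `Cruxes/BlochSeedDiscOne/Lines/birth.lean` 814a6a70c14e831a,
stub `stub_rung_pad4_seedAt`, screen (H1) = the class condition (A1)). Tenth file of the KERNEL LEMMA Ψ ⊂ (A1) set; sequel of (F)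
`Pad4TowerFCCoreSeam` (typer-2 g4, p603640: the modelling sentence of gs-eng-2 g51's kernel LEMMA FC-CORE `Pad4FCCore` p588880 PROVED in the
class frame for the two-phase window `𝒜_{1,i}`) and of (I) `Pad4TowerDelta2Window` (Δ²). THE OBSERVATION TYPED HERE: (F)'s per-letter
dictionary `bphi_win` — «ē-entry `= chargeOf · i^{kbit}`, e-entry `= chargeOf · i^{3·kbit}`» with `kbit x = [Im β ≠ 0]`, `chargeOf x = Re β − Im β`
— is TRUE FOR EVERY AXIS LETTER `β ∈ {c, −ci, −c, ci}` (all of 𝔅(μ₄)'s charged letters `c·ζ̄`, `ζ ∈ μ₄`, and their negatives), not only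
for the window `{c, −ci}`: for `ζ = i^k` one has `kbit = k mod 2` (the PARITY of the phase) and `chargeOf = (−1)^{[k ≥ 2]} · c` (the charge
with the ANTIPODAL SIGN). Consequently (F)'s `MCell.pat` IS the parity pattern `ρ(Z)`, (F)'s `MCell.cprod` IS `(−1)^{#{f : k_f ≥ 2}} · C_Z`, and
(F)'s aggregate `MConfig.xPat` IS the PARITY AGGREGATE `X_ρ = Σ_{κ ≡ ρ (2)} (−1)^{#{f : κ_f ≥ 2}} x_κ` of LEMMA FC-CORE §1b (gs-eng-2 g51 note
v1.1 2f114c6fc620d49c; kernel rows 843 `Pad4FCCoreParity` p590034 ∕ 872 `Pad4FCCoreRingParity` p601917, whose header records the per-term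
PARITY IDENTITY `i^{⟨κ,s⟩} = i^{⟨κ mod 2, s⟩}·(−1)^{#{f : κ_f ≥ 2}}` this rests on) — so `Pad4FCCore`'s sixteen-pattern theorem applied to
`xPat` over an ARBITRARY 𝔅(μ₄) configuration IS the parity form. Card v4.15 row W13: «on the whole of 𝔅(μ₄) X_ρ = Re(μ·i^{−|ρ|})∕8 per PARITY
pattern ρ (antipodal sign (−1)^{#(−1, −i) factors}) ⇒ every (H1)-feasible two-level 𝔅(μ₄) support — any phases, any height, symmetric or
not — has FC classes in ≥ 8 distinct parity patterns (all eight even-weight if Re μ ≠ 0, all eight odd-weight if Im μ ≠ 0)». THIS FILE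
proves that sentence for weighted `MConfig`s from (A1), and the orbit consequences gs-eng-2 g51 drew from it: RESULT 15 (3) (l.32053: «Δ²
preserves the parity pattern ρ AND the antipodal sign … so a Δ²-orbit {Z, −Z} sits in ONE parity pattern with no cancellation ⇒
⟨Δ²⟩-invariant (H1) designs need ≥ 8 FC Δ²-orbits (≥ 16 FC classes)»), RESULT 10 ∕ COROLLARY 1b for Δ (card W14: «Δ maps a parity pattern
ρ to its complement … with an orbit-intrinsic sign»), and the sentence that killed the ◇₈ no-Ψ witness a priori (gs-eng-2 g51 l.32088, card
W14d: «the lone FC orbit has weight type {0,4} only (parity RRRR∕IIII), so by LEMMA FC-CORE … the even core lacks a weight-{2} orbit … and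
the odd core a weight-{1,3} orbit, for every choice of multiplicities»).

CONTENT (all PROVED; no `sorry`; axioms standard).
* §1 `AxisPt x` (`β ≠ 0` on a coordinate axis: exactly one of `Re β`, `Im β` non-zero), `AxisCell`, `WinPt.axisPt`, `axisPt_lpt` (every
  𝔅(μ₄) letter `lpt c k`, `c ≠ 0`, is an axis letter; `kbit (lpt c k) = k mod 2`, `chargeOf (lpt c k) = ± c` with the antipodal sign —
  `kbit_chargeOf_lpt`), **`bphi_axis`** ((F)'s dictionary for all four phases), **`MCell.ch_sWord_axis`: `ch(Z)(w_s) = C±_Z · i^{⟨ρ(Z), s⟩}`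
  for EVERY fully charged axis cell** — the modelling sentence of the PARITY FORM, per class; `pwt` (parity weight `|ρ|`).
* §2 THE SEAM FOR ALL OF 𝔅(μ₄) ((F) §3–§4 with `WinCell` weakened to `AxisCell`, proofs verbatim): `sum_ch_sWord_axis`, **`MConfig.wch_sWord_axis`**
  (`wch(w_s) = Σ_ρ X_ρ · i^{⟨ρ,s⟩}`), `MConfig.rows_of_classScreen_axis`, **`MConfig.mixedRowsVanish_of_classScreen_axis`** (`Pad4FCCore.MixedRowsVanish`
  for the parity aggregates), `MConfig.mu_fcCore_axis`, **`MConfig.eight_parity_patterns_of_classScreen`** (+ `'` with the `eeee` hypothesis):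
  (A1) + `wch(ēēēē) ≠ 0` ⇒ all eight even-weight or all eight odd-weight PARITY aggregates `X_ρ ≠ 0`; **`MConfig.parity_weights_of_classScreen`**:
  hence present FC classes of parity weights 0, 2 AND 4 (even core) or 1 AND 3 (odd core); **`MConfig.not_classScreen_of_weights_zero_four`**:
  a configuration all of whose fully charged classes have parity weight in {0, 4} admits NO multiplicity vector with (A1) and μ ≠ 0.
* §3 ORBIT FORMS. `kbit_chargeOf_neg` ⇒ **`MCell.pat_delta2`, `MCell.cprod_delta2`** (Δ² preserves parity pattern AND signed charge product —
  RESULT 15 (3) «no cancellation»), `MCell.fcc_delta2`, `MCell.delta2_ne_self`; **`MConfig.sixteen_fc_of_d2Closed`**: on a Δ²-closed support,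
  (A1) + μ ≠ 0 ⇒ eight parity patterns each holding a present FC class `Z` together with the distinct present FC class `Δ²Z` of the same
  pattern (≥ 16 FC classes); `kbit_deltaPt ∕ chargeOf_deltaPt` ⇒ **`MCell.bitOf_pat_delta`** (Δ COMPLEMENTS the parity pattern: `ρ ↦ ρ̄`) and
  **`MCell.cprod_delta`** (`C± ↦ (−1)^{#{f : ρ_f = 0}} · C±`, the orbit-intrinsic sign), `MCell.cprod_perm` ∕ `MCell.kbit_perm` (S₄ permutes the
  pattern's bits, fixes `C±`).
* §4 probes (`decide`) on `fcCell = [ℓ₁|ℓ₋ᵢ|ℓ₋₁|ℓ_i]` (all four phases: parity pattern `0101 = 5`, signed charge product `+1`, the sentence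
  `ch(w_s) = C± i^{⟨ρ,s⟩}` at three sign vectors) and on `Δ fcCell`, `Δ² fcCell`.

WHAT IS NOT HERE ∕ NOT IN LEAN. The identification of `xPat` read on axis cells with `Pad4FCCoreParity`'s 256-pattern `X_ρ` is by
INSPECTION of the two definitions (same sign `(−1)^{#{k_f ≥ 2}}`, same parity classes) — this file does not import row 843 ∕ 872 and proves
the parity conclusions directly from row 840 `Pad4FCCore` through (F); the 256-pattern bookkeeping is therefore not needed here. G₁-orbit
counting («a G₁-orbit meets all patterns of two complementary weights», RESULT 14's 2 ∕ 1 and RESULT 15 (3)'s 3 ∕ 2 orbit minima) is left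
at the level of its two ingredients `bitOf_pat_delta` ∕ `kbit_perm` + `parity_weights_of_classScreen`; face balance, the (H1) LP, Burnside
counts, any SAT verdict: not here. The frame's identification with `H^{ev}(S⁴)` and of the screen with PAD4-FIRSTORDER §0's (A1)-target stays the
cell's pencil modelling sentence (as for 840 ∕ (F)). No variety, sheaf, σ, seed or abelian variety; NOTHING HERE SAYS THAT HC ∕ HC_CM ∕ HC_AV ∕
W₆ ∕ HC_Kum4Type HOLDS OR FAILS. No `instance`, no notation, no named fact, 0 `sorry`.

SOURCES (sha16 ∕ bus): (F) `Pad4TowerFCCoreSeam.lean` afb1e6d84449a076 (p603640); `Pad4FCCore.lean` 77cf033c04df8791 (p588880); `Pad4FCCoreParity.lean` (p590034) ∕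
`Pad4FCCoreRingParity.lean` 408690dd2dda9b36 (p601917) headers (parity identity, `X_ρ`); LEMMA-FCCORE-gs2g51.md v1.3 eed5177b5e337200 §1b; gs-eng-2 g51 RESULT 10
l.31860, RESULT 14 l.31979, RESULT 15 (3) l.32053, l.32088; card `birth-v4.md` v4.15 96eae72e810e9d81 rows W13 ∕ W14 ∕ W14b ∕ W14d; (I) `Pad4TowerDelta2Window.lean`. -/

namespace Summit.Ventures.HSemireg.Pad4Tower

open Finset

/-! ## §1 Axis letters: (F)'s dictionary holds for all four phases; the modelling sentence in parity form -/

/-- an AXIS LETTER: `β ≠ 0` lies on a coordinate axis — `β ∈ {c, −ci, −c, ci}`, i.e. every charged letter `c·ζ̄` of 𝔅(μ₄) (`ζ ∈ μ₄`)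
and its negative. Decidable. ((F)'s `WinPt` is the sub-case `β ∈ {c, −ci}`, `c > 0`.) -/
abbrev AxisPt (x : BPoint) : Prop := (x.2.1 ≠ 0 ∧ x.2.2 = 0) ∨ (x.2.1 = 0 ∧ x.2.2 ≠ 0)

/-- every factor of the cell is an axis letter (a fully charged 𝔅(μ₄) class, any phases). -/
abbrev AxisCell (Z : MCell) : Prop := ∀ f, AxisPt (Z f)

/-- window letters are axis letters. -/
theorem WinPt.axisPt {x : BPoint} (hx : WinPt x) : AxisPt x :=
  hx.elim (fun h => Or.inl ⟨ne_of_gt h.1, h.2⟩) fun h => Or.inr ⟨h.1, ne_of_lt h.2⟩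

/-- every 𝔅(μ₄) charged letter `c·ℓ_{i^k} = lpt c k` with `c ≠ 0` is an axis letter. -/
theorem axisPt_lpt (c : ℤ) (hc : c ≠ 0) (k : Fin 4) : AxisPt (lpt c k) := by
  fin_cases k <;> simp [AxisPt, lpt, ray, hc]

/-- **(F)'s PATTERN BIT IS THE PHASE PARITY, (F)'s CHARGE IS THE SIGNED CHARGE**: on `lpt c k` (`β = c·conj(i^k)`), `kbit = k mod 2` and
`chargeOf = c, c, −c, −c` for `k = 0, 1, 2, 3` — the antipodal sign `(−1)^{[k ≥ 2]}` of LEMMA FC-CORE §1b's parity aggregate. -/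
theorem kbit_chargeOf_lpt (c : ℤ) (hc : c ≠ 0) :
    (kbit (lpt c 0) = 0 ∧ chargeOf (lpt c 0) = c) ∧ (kbit (lpt c 1) = 1 ∧ chargeOf (lpt c 1) = c) ∧
      (kbit (lpt c 2) = 0 ∧ chargeOf (lpt c 2) = -c) ∧ (kbit (lpt c 3) = 1 ∧ chargeOf (lpt c 3) = -c) := by
  simp [kbit, chargeOf, lpt, ray, hc]

/-- **(F)'s LETTER DICTIONARY FOR ALL FOUR PHASES**: on an axis letter the `ē`-entry is `chargeOf · i^{kbit}` and the `e`-entry is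
`chargeOf · i^{3·kbit}` (generalises `bphi_win`; the signed charge absorbs the antipode). -/
theorem bphi_axis (x : BPoint) (hx : AxisPt x) :
    bphi x 4 = (chargeOf x : GaussianInt) * unitI ^ kbit x ∧ bphi x 3 = (chargeOf x : GaussianInt) * unitI ^ (3 * kbit x) := by
  obtain ⟨α, b1, b2⟩ := x
  rcases hx with ⟨hb1, hb2⟩ | ⟨hb1, hb2⟩
  · simp only at hb2
    subst hb2
    simp [bphi, phiVec, chargeOf, kbit, unitI, Zsqrtd.ext_iff]
  · simp only at hb1
    subst hb1
    simp only at hb2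
    simp [bphi, phiVec, chargeOf, kbit, unitI, Zsqrtd.ext_iff, hb2, pow_succ]

/-- **THE MODELLING SENTENCE OF THE PARITY FORM, per class**: on a fully charged AXIS cell (any phases) the coefficient of the word of the
sign vector `s` is `C±_Z · i^{⟨ρ(Z), s⟩}` with `ρ(Z) = MCell.pat Z` the PARITY pattern and `C±_Z = MCell.cprod Z` the SIGNED charge product
((F)'s `MCell.ch_sWord`, hypothesis weakened from `WinCell` to `AxisCell`; proof verbatim). -/
theorem MCell.ch_sWord_axis (Z : MCell) (hZ : AxisCell Z) (s : Fin 16) :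
    Z.ch (sWord s) = (Z.cprod : GaussianInt) * unitI ^ expKS Z.pat s := by
  have key : ∀ f, bphi (Z f) (sWord s f) =
      (chargeOf (Z f) : GaussianInt) * unitI ^ (kbit (Z f) * if bitOf s f = 0 then 1 else 3) := by
    intro f
    obtain ⟨h4, h3⟩ := bphi_axis (Z f) (hZ f)
    by_cases hb : bitOf s f = 0
    · simp [sWord, hb, h4]
    · simp [sWord, hb, h3, mul_comm]
  rw [MCell.ch, chTensor, key 0, key 1, key 2, key 3, expKS, Fin.sum_univ_four, bitOf_pat, bitOf_pat, bitOf_pat, bitOf_pat,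
    ← unitI_pow_mod, MCell.cprod]
  push_cast
  ring

/-- the PARITY WEIGHT `|ρ|` of a pattern index: the number of imaginary-phase factors. -/
def pwt (κ : Fin 16) : ℕ := bitOf κ 0 + bitOf κ 1 + bitOf κ 2 + bitOf κ 3

/-- the weights of the sixteen patterns: `0 ↦ 0`, `15 ↦ 4`, `{3,5,6,9,10,12} ↦ 2`, `{1,2,4,8} ↦ 1`, `{7,11,13,14} ↦ 3`. [`decide`] -/
theorem pwt_table : pwt 0 = 0 ∧ pwt 15 = 4 ∧ pwt 3 = 2 ∧ pwt 1 = 1 ∧ pwt 7 = 3 ∧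
    (∀ κ : Fin 16, pwt κ % 2 = 0 ↔ κ = 0 ∨ κ = 3 ∨ κ = 5 ∨ κ = 6 ∨ κ = 9 ∨ κ = 10 ∨ κ = 12 ∨ κ = 15) := by
  decide

/-! ## §2 The seam for all of 𝔅(μ₄): (A1) ⇒ `Pad4FCCore.MixedRowsVanish` for the parity aggregates ⇒ ≥ 8 parity patterns -/

/-- one level, axis cells: `Σ_{Z ∈ S} m_Z ch(Z)(w_s) = Σ_ρ (Σ_{Z ∈ S FC, ρ(Z)=ρ} m_Z C±_Z) · i^{⟨ρ,s⟩}` ((F) `sum_ch_sWord`, verbatim). -/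
theorem sum_ch_sWord_axis (S : Finset MCell) (m : MCell → ℤ) (hS : ∀ Z ∈ S, FCc Z → AxisCell Z) (s : Fin 16) :
    ∑ Z ∈ S, (m Z : GaussianInt) * Z.ch (sWord s) =
      ∑ κ : Fin 16, ((∑ Z ∈ S.filter (fun Z => FCc Z ∧ Z.pat = κ), m Z * Z.cprod : ℤ) : GaussianInt) * unitI ^ expKS κ s := by
  have h1 : ∑ Z ∈ S, (m Z : GaussianInt) * Z.ch (sWord s) = ∑ Z ∈ S.filter FCc, (m Z : GaussianInt) * Z.ch (sWord s) := by
    rw [Finset.sum_filter]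
    refine Finset.sum_congr rfl fun Z _ => ?_
    by_cases hZ : FCc Z
    · simp [hZ]
    · simp only [hZ, if_false]
      obtain ⟨f, hf⟩ : ∃ f, (Z f).2 = (0, 0) := by simpa [FCc] using hZ
      simp [Z.ch_sWord_eq_zero f hf s]
  rw [h1, ← Finset.sum_fiberwise (S.filter FCc) MCell.pat]
  refine Finset.sum_congr rfl fun κ _ => ?_
  rw [Finset.filter_filter, Int.cast_sum, Finset.sum_mul]
  refine Finset.sum_congr rfl fun Z hZ => ?_
  obtain ⟨hZS, hFC, hpat⟩ := Finset.mem_filter.1 hZ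
  rw [Z.ch_sWord_axis (hS Z hZS hFC) s, hpat]
  push_cast
  ring

/-- **THE ROW IDENTITY FOR ALL OF 𝔅(μ₄)**: `wch(w_s) = Σ_ρ X_ρ · i^{⟨ρ,s⟩}` with `X_ρ = MConfig.xPat` the PARITY aggregates, for every weighted
configuration whose fully charged classes are axis cells. -/
theorem MConfig.wch_sWord_axis (C : MConfig) (mN mP : MCell → ℤ) (hN : ∀ Z ∈ C.lower, FCc Z → AxisCell Z)
    (hP : ∀ P ∈ C.upper, FCc P → AxisCell P) (s : Fin 16) :
    C.wch mN mP (sWord s) = ∑ κ : Fin 16, (C.xPat mN mP κ : GaussianInt) * unitI ^ expKS κ s := by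
  simp only [MConfig.wch, Pi.sub_apply, Finset.sum_apply, Pi.smul_apply]
  simp only [zsmul_eq_mul]
  rw [sum_ch_sWord_axis C.lower mN hN s, sum_ch_sWord_axis C.upper mP hP s, ← Finset.sum_sub_distrib]
  refine Finset.sum_congr rfl fun κ _ => ?_
  rw [MConfig.xPat]
  push_cast
  ring

/-- (A1) ⇒ both parts of every mixed row vanish (axis cells). -/
theorem MConfig.rows_of_classScreen_axis (C : MConfig) (mN mP : MCell → ℤ) (hN : ∀ Z ∈ C.lower, FCc Z → AxisCell Z)
    (hP : ∀ P ∈ C.upper, FCc P → AxisCell P) (hA : ClassScreen (C.wch mN mP)) (s : Fin 16) (hs : s ≠ 0 ∧ s ≠ 15) :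
    ∑ κ : Fin 16, C.xPat mN mP κ * (unitI ^ expKS κ s).re = 0 ∧ ∑ κ : Fin 16, C.xPat mN mP κ * (unitI ^ expKS κ s).im = 0 := by
  obtain ⟨hnf, -, -, hne⟩ := sWord_spec
  have h0 : C.wch mN mP (sWord s) = 0 := hA.1 (sWord s) (hnf s) (hne s hs.1 hs.2).1 (hne s hs.1 hs.2).2
  rw [C.wch_sWord_axis mN mP hN hP s] at h0
  have hre := congrArg reHom h0
  have him := congrArg imHom h0
  rw [map_sum, map_zero] at hre him
  constructor
  · rw [← hre]
    exact Finset.sum_congr rfl fun κ _ => by simp [reHom, Zsqrtd.re_mul, Zsqrtd.re_intCast, Zsqrtd.im_intCast]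
  · rw [← him]
    exact Finset.sum_congr rfl fun κ _ => by simp [imHom, Zsqrtd.im_mul, Zsqrtd.re_intCast, Zsqrtd.im_intCast]

/-- **KERNEL FC-CORE'S HYPOTHESIS FROM (A1), ALL OF 𝔅(μ₄)**: for every configuration whose fully charged classes are AXIS cells (any phases)
and every integer multiplicity vector, (A1) on the weighted class tensor implies `Pad4FCCore.MixedRowsVanish` for the PARITY aggregates `X_ρ`
(the 28 coefficient tables of (F), unchanged — they depend on `(ρ, s)` only). -/
theorem MConfig.mixedRowsVanish_of_classScreen_axis (C : MConfig) (mN mP : MCell → ℤ) (hN : ∀ Z ∈ C.lower, FCc Z → AxisCell Z)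
    (hP : ∀ P ∈ C.upper, FCc P → AxisCell P) (hA : ClassScreen (C.wch mN mP)) :
    Pad4FCCore.MixedRowsVanish fun κ => (C.xPat mN mP κ : ℚ) :=
  ⟨
    (by have h := dot16q _ _ ![1, 0, 0, 1, 0, 1, -1, 0, 0, 1, -1, 0, -1, 0, 0, -1] (by decide) (C.rows_of_classScreen_axis mN mP hN hP hA 1 (by decide)).1; simp only [Matrix.cons_val] at h; push_cast at h ⊢; linarith),
    (by have h := dot16q _ _ ![0, -1, 1, 0, 1, 0, 0, 1, 1, 0, 0, 1, 0, 1, -1, 0] (by decide) (C.rows_of_classScreen_axis mN mP hN hP hA 1 (by decide)).2; simp only [Matrix.cons_val] at h; push_cast at h ⊢; linarith),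
    (by have h := dot16q _ _ ![1, 0, 0, 1, 0, -1, 1, 0, 0, -1, 1, 0, -1, 0, 0, -1] (by decide) (C.rows_of_classScreen_axis mN mP hN hP hA 2 (by decide)).1; simp only [Matrix.cons_val] at h; push_cast at h ⊢; linarith),
    (by have h := dot16q _ _ ![0, 1, -1, 0, 1, 0, 0, 1, 1, 0, 0, 1, 0, -1, 1, 0] (by decide) (C.rows_of_classScreen_axis mN mP hN hP hA 2 (by decide)).2; simp only [Matrix.cons_val] at h; push_cast at h ⊢; linarith),
    (by have h := dot16q _ _ ![1, 0, 0, -1, 0, 1, 1, 0, 0, 1, 1, 0, -1, 0, 0, 1] (by decide) (C.rows_of_classScreen_axis mN mP hN hP hA 3 (by decide)).1; simp only [Matrix.cons_val] at h; push_cast at h ⊢; linarith),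
    (by have h := dot16q _ _ ![0, -1, -1, 0, 1, 0, 0, -1, 1, 0, 0, -1, 0, 1, 1, 0] (by decide) (C.rows_of_classScreen_axis mN mP hN hP hA 3 (by decide)).2; simp only [Matrix.cons_val] at h; push_cast at h ⊢; linarith),
    (by have h := dot16q _ _ ![1, 0, 0, -1, 0, 1, 1, 0, 0, -1, -1, 0, 1, 0, 0, -1] (by decide) (C.rows_of_classScreen_axis mN mP hN hP hA 4 (by decide)).1; simp only [Matrix.cons_val] at h; push_cast at h ⊢; linarith),
    (by have h := dot16q _ _ ![0, 1, 1, 0, -1, 0, 0, 1, 1, 0, 0, -1, 0, 1, 1, 0] (by decide) (C.rows_of_classScreen_axis mN mP hN hP hA 4 (by decide)).2; simp only [Matrix.cons_val] at h; push_cast at h ⊢; linarith),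
    (by have h := dot16q _ _ ![1, 0, 0, 1, 0, -1, 1, 0, 0, 1, -1, 0, 1, 0, 0, 1] (by decide) (C.rows_of_classScreen_axis mN mP hN hP hA 5 (by decide)).1; simp only [Matrix.cons_val] at h; push_cast at h ⊢; linarith),
    (by have h := dot16q _ _ ![0, -1, 1, 0, -1, 0, 0, -1, 1, 0, 0, 1, 0, -1, 1, 0] (by decide) (C.rows_of_classScreen_axis mN mP hN hP hA 5 (by decide)).2; simp only [Matrix.cons_val] at h; push_cast at h ⊢; linarith),
    (by have h := dot16q _ _ ![1, 0, 0, 1, 0, 1, -1, 0, 0, -1, 1, 0, 1, 0, 0, 1] (by decide) (C.rows_of_classScreen_axis mN mP hN hP hA 6 (by decide)).1; simp only [Matrix.cons_val] at h; push_cast at h ⊢; linarith),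
    (by have h := dot16q _ _ ![0, 1, -1, 0, -1, 0, 0, -1, 1, 0, 0, 1, 0, 1, -1, 0] (by decide) (C.rows_of_classScreen_axis mN mP hN hP hA 6 (by decide)).2; simp only [Matrix.cons_val] at h; push_cast at h ⊢; linarith),
    (by have h := dot16q _ _ ![1, 0, 0, -1, 0, -1, -1, 0, 0, 1, 1, 0, 1, 0, 0, -1] (by decide) (C.rows_of_classScreen_axis mN mP hN hP hA 7 (by decide)).1; simp only [Matrix.cons_val] at h; push_cast at h ⊢; linarith),
    (by have h := dot16q _ _ ![0, -1, -1, 0, -1, 0, 0, 1, 1, 0, 0, -1, 0, -1, -1, 0] (by decide) (C.rows_of_classScreen_axis mN mP hN hP hA 7 (by decide)).2; simp only [Matrix.cons_val] at h; push_cast at h ⊢; linarith),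
    (by have h := dot16q _ _ ![1, 0, 0, -1, 0, -1, -1, 0, 0, 1, 1, 0, 1, 0, 0, -1] (by decide) (C.rows_of_classScreen_axis mN mP hN hP hA 8 (by decide)).1; simp only [Matrix.cons_val] at h; push_cast at h ⊢; linarith),
    (by have h := dot16q _ _ ![0, 1, 1, 0, 1, 0, 0, -1, -1, 0, 0, 1, 0, 1, 1, 0] (by decide) (C.rows_of_classScreen_axis mN mP hN hP hA 8 (by decide)).2; simp only [Matrix.cons_val] at h; push_cast at h ⊢; linarith),
    (by have h := dot16q _ _ ![1, 0, 0, 1, 0, 1, -1, 0, 0, -1, 1, 0, 1, 0, 0, 1] (by decide) (C.rows_of_classScreen_axis mN mP hN hP hA 9 (by decide)).1; simp only [Matrix.cons_val] at h; push_cast at h ⊢; linarith),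
    (by have h := dot16q _ _ ![0, -1, 1, 0, 1, 0, 0, 1, -1, 0, 0, -1, 0, -1, 1, 0] (by decide) (C.rows_of_classScreen_axis mN mP hN hP hA 9 (by decide)).2; simp only [Matrix.cons_val] at h; push_cast at h ⊢; linarith),
    (by have h := dot16q _ _ ![1, 0, 0, 1, 0, -1, 1, 0, 0, 1, -1, 0, 1, 0, 0, 1] (by decide) (C.rows_of_classScreen_axis mN mP hN hP hA 10 (by decide)).1; simp only [Matrix.cons_val] at h; push_cast at h ⊢; linarith),
    (by have h := dot16q _ _ ![0, 1, -1, 0, 1, 0, 0, 1, -1, 0, 0, -1, 0, 1, -1, 0] (by decide) (C.rows_of_classScreen_axis mN mP hN hP hA 10 (by decide)).2; simp only [Matrix.cons_val] at h; push_cast at h ⊢; linarith),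
    (by have h := dot16q _ _ ![1, 0, 0, -1, 0, 1, 1, 0, 0, -1, -1, 0, 1, 0, 0, -1] (by decide) (C.rows_of_classScreen_axis mN mP hN hP hA 11 (by decide)).1; simp only [Matrix.cons_val] at h; push_cast at h ⊢; linarith),
    (by have h := dot16q _ _ ![0, -1, -1, 0, 1, 0, 0, -1, -1, 0, 0, 1, 0, -1, -1, 0] (by decide) (C.rows_of_classScreen_axis mN mP hN hP hA 11 (by decide)).2; simp only [Matrix.cons_val] at h; push_cast at h ⊢; linarith),
    (by have h := dot16q _ _ ![1, 0, 0, -1, 0, 1, 1, 0, 0, 1, 1, 0, -1, 0, 0, 1] (by decide) (C.rows_of_classScreen_axis mN mP hN hP hA 12 (by decide)).1; simp only [Matrix.cons_val] at h; push_cast at h ⊢; linarith),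
    (by have h := dot16q _ _ ![0, 1, 1, 0, -1, 0, 0, 1, -1, 0, 0, 1, 0, -1, -1, 0] (by decide) (C.rows_of_classScreen_axis mN mP hN hP hA 12 (by decide)).2; simp only [Matrix.cons_val] at h; push_cast at h ⊢; linarith),
    (by have h := dot16q _ _ ![1, 0, 0, 1, 0, -1, 1, 0, 0, -1, 1, 0, -1, 0, 0, -1] (by decide) (C.rows_of_classScreen_axis mN mP hN hP hA 13 (by decide)).1; simp only [Matrix.cons_val] at h; push_cast at h ⊢; linarith),
    (by have h := dot16q _ _ ![0, -1, 1, 0, -1, 0, 0, -1, -1, 0, 0, -1, 0, 1, -1, 0] (by decide) (C.rows_of_classScreen_axis mN mP hN hP hA 13 (by decide)).2; simp only [Matrix.cons_val] at h; push_cast at h ⊢; linarith),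
    (by have h := dot16q _ _ ![1, 0, 0, 1, 0, 1, -1, 0, 0, 1, -1, 0, -1, 0, 0, -1] (by decide) (C.rows_of_classScreen_axis mN mP hN hP hA 14 (by decide)).1; simp only [Matrix.cons_val] at h; push_cast at h ⊢; linarith),
    (by have h := dot16q _ _ ![0, 1, -1, 0, -1, 0, 0, -1, -1, 0, 0, -1, 0, -1, 1, 0] (by decide) (C.rows_of_classScreen_axis mN mP hN hP hA 14 (by decide)).2; simp only [Matrix.cons_val] at h; push_cast at h ⊢; linarith)⟩

/-- `Pad4FCCore`'s `μ` of the parity aggregates is the `ēēēē`-coefficient of the weighted class tensor ((F) `mu_fcCore`, axis cells). -/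
theorem MConfig.mu_fcCore_axis (C : MConfig) (mN mP : MCell → ℤ) (hN : ∀ Z ∈ C.lower, FCc Z → AxisCell Z)
    (hP : ∀ P ∈ C.upper, FCc P → AxisCell P) :
    Pad4FCCore.muRe (fun κ => (C.xPat mN mP κ : ℚ)) = ((C.wch mN mP ebarWord).re : ℚ) ∧
      Pad4FCCore.muIm (fun κ => (C.xPat mN mP κ : ℚ)) = ((C.wch mN mP ebarWord).im : ℚ) := by
  obtain ⟨-, h0, -, -⟩ := sWord_spec
  have hw := C.wch_sWord_axis mN mP hN hP 0
  rw [h0] at hw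
  have hre := congrArg reHom hw
  have him := congrArg imHom hw
  rw [map_sum] at hre him
  have hre' : (C.wch mN mP ebarWord).re = ∑ κ : Fin 16, C.xPat mN mP κ * (unitI ^ expKS κ 0).re :=
    hre.trans (Finset.sum_congr rfl fun κ _ => by simp [reHom, Zsqrtd.re_mul, Zsqrtd.re_intCast, Zsqrtd.im_intCast])
  have him' : (C.wch mN mP ebarWord).im = ∑ κ : Fin 16, C.xPat mN mP κ * (unitI ^ expKS κ 0).im :=
    him.trans (Finset.sum_congr rfl fun κ _ => by simp [imHom, Zsqrtd.im_mul, Zsqrtd.re_intCast, Zsqrtd.im_intCast])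
  have vre : (fun κ : Fin 16 => (unitI ^ expKS κ 0).re) = ![1, 0, 0, -1, 0, -1, -1, 0, 0, -1, -1, 0, -1, 0, 0, 1] := by decide
  have vim : (fun κ : Fin 16 => (unitI ^ expKS κ 0).im) = ![0, 1, 1, 0, 1, 0, 0, -1, 1, 0, 0, -1, 0, -1, -1, 0] := by decide
  rw [hre', him', show (fun κ : Fin 16 => C.xPat mN mP κ * (unitI ^ expKS κ 0).re) =
      fun κ => C.xPat mN mP κ * (![1, 0, 0, -1, 0, -1, -1, 0, 0, -1, -1, 0, -1, 0, 0, 1] : Fin 16 → ℤ) κ from by rw [← vre],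
    show (fun κ : Fin 16 => C.xPat mN mP κ * (unitI ^ expKS κ 0).im) =
      fun κ => C.xPat mN mP κ * (![0, 1, 1, 0, 1, 0, 0, -1, 1, 0, 0, -1, 0, -1, -1, 0] : Fin 16 → ℤ) κ from by rw [← vim], sum16, sum16]
  simp only [Matrix.cons_val, Pad4FCCore.muRe, Pad4FCCore.muIm]
  push_cast
  constructor <;> ring

/-- **LEMMA FC-CORE §1b ∕ COROLLARY 1b FOR WEIGHTED 𝔅(μ₄) CONFIGURATIONS** (card W13 «on the whole of 𝔅(μ₄) … ≥ 8 distinct parity patterns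
(all eight even-weight if Re μ ≠ 0, all eight odd-weight if Im μ ≠ 0)»): if the fully charged classes are axis cells, the weighted class
tensor passes (A1) and its `ēēēē`-coefficient is non-zero, then the PARITY aggregates `X_ρ = xPat ρ` are non-zero at ALL EIGHT even-weight
parity patterns or at ALL EIGHT odd-weight ones. -/
theorem MConfig.eight_parity_patterns_of_classScreen (C : MConfig) (mN mP : MCell → ℤ) (hN : ∀ Z ∈ C.lower, FCc Z → AxisCell Z)
    (hP : ∀ P ∈ C.upper, FCc P → AxisCell P) (hA : ClassScreen (C.wch mN mP)) (hμ : C.wch mN mP ebarWord ≠ 0) :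
    let x : Fin 16 → ℚ := fun κ => (C.xPat mN mP κ : ℚ)
    (x 0 ≠ 0 ∧ x 3 ≠ 0 ∧ x 5 ≠ 0 ∧ x 6 ≠ 0 ∧ x 9 ≠ 0 ∧ x 10 ≠ 0 ∧ x 12 ≠ 0 ∧ x 15 ≠ 0) ∨
      (x 1 ≠ 0 ∧ x 2 ≠ 0 ∧ x 4 ≠ 0 ∧ x 7 ≠ 0 ∧ x 8 ≠ 0 ∧ x 11 ≠ 0 ∧ x 13 ≠ 0 ∧ x 14 ≠ 0) := by
  intro x
  apply Pad4FCCore.eight_patterns_of_mu_ne x (C.mixedRowsVanish_of_classScreen_axis mN mP hN hP hA)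
  obtain ⟨hre, him⟩ := C.mu_fcCore_axis mN mP hN hP
  by_contra hc
  push Not at hc
  apply hμ
  refine Zsqrtd.ext ?_ ?_
  · have := hc.1; rw [hre] at this; exact_mod_cast this
  · have := hc.2; rw [him] at this; exact_mod_cast this

/-- the same with the hypothesis on the `eeee`-coefficient (FILE A's μ-word orientation; `wch(ēēēē) = conj wch(eeee)`). -/
theorem MConfig.eight_parity_patterns_of_classScreen' (C : MConfig) (mN mP : MCell → ℤ) (hN : ∀ Z ∈ C.lower, FCc Z → AxisCell Z)
    (hP : ∀ P ∈ C.upper, FCc P → AxisCell P) (hA : ClassScreen (C.wch mN mP)) (hμ : C.wch mN mP eWord ≠ 0) :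
    let x : Fin 16 → ℚ := fun κ => (C.xPat mN mP κ : ℚ)
    (x 0 ≠ 0 ∧ x 3 ≠ 0 ∧ x 5 ≠ 0 ∧ x 6 ≠ 0 ∧ x 9 ≠ 0 ∧ x 10 ≠ 0 ∧ x 12 ≠ 0 ∧ x 15 ≠ 0) ∨
      (x 1 ≠ 0 ∧ x 2 ≠ 0 ∧ x 4 ≠ 0 ∧ x 7 ≠ 0 ∧ x 8 ≠ 0 ∧ x 11 ≠ 0 ∧ x 13 ≠ 0 ∧ x 14 ≠ 0) :=
  C.eight_parity_patterns_of_classScreen mN mP hN hP hA ((C.wch_ebarWord_ne_zero_iff mN mP).2 hμ)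

/-- a PRESENT fully charged class of parity pattern `κ`. -/
abbrev MConfig.HasFC (C : MConfig) (κ : Fin 16) : Prop := ∃ Z, (Z ∈ C.lower ∨ Z ∈ C.upper) ∧ FCc Z ∧ Z.pat = κ

/-- **THE PARITY WEIGHTS AN (A1)-FEASIBLE SUPPORT MUST SHOW** (gs-eng-2 g51 RESULT 14 ∕ l.32088, weight form): (A1) + μ ≠ 0 ⇒ the support
holds present fully charged classes of parity weights `0`, `2` AND `4` (even core: patterns `0000`, `0011`, `1111`) or of parity weights `1`
AND `3` (odd core: patterns `0001`, `0111`). -/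
theorem MConfig.parity_weights_of_classScreen (C : MConfig) (mN mP : MCell → ℤ) (hN : ∀ Z ∈ C.lower, FCc Z → AxisCell Z)
    (hP : ∀ P ∈ C.upper, FCc P → AxisCell P) (hA : ClassScreen (C.wch mN mP)) (hμ : C.wch mN mP eWord ≠ 0) :
    (C.HasFC 0 ∧ C.HasFC 3 ∧ C.HasFC 15) ∨ (C.HasFC 1 ∧ C.HasFC 7) := by
  rcases C.eight_parity_patterns_of_classScreen' mN mP hN hP hA hμ with ⟨h0, h3, -, -, -, -, -, h15⟩ | ⟨h1, -, -, h7, -, -, -, -⟩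
  · exact Or.inl ⟨C.exists_of_xPat_ne mN mP 0 h0, C.exists_of_xPat_ne mN mP 3 h3, C.exists_of_xPat_ne mN mP 15 h15⟩
  · exact Or.inr ⟨C.exists_of_xPat_ne mN mP 1 h1, C.exists_of_xPat_ne mN mP 7 h7⟩

/-- **A SUPPORT WHOSE FULLY CHARGED CLASSES ALL HAVE PARITY WEIGHT 0 OR 4 IS (A1)-INFEASIBLE WITH μ ≠ 0, FOR EVERY MULTIPLICITY VECTOR**
(the a-priori death of the ◇₈ no-Ψ witness, card W14d: «FC content = ONE G₁-orbit … weight type {0,4} only (parity RRRR∕IIII) ⇒ by LEMMA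
FC-CORE … the even core lacks a weight-{2} orbit … and the odd core a weight-{1,3} orbit, for every choice of multiplicities»). -/
theorem MConfig.not_classScreen_of_weights_zero_four (C : MConfig) (mN mP : MCell → ℤ) (hN : ∀ Z ∈ C.lower, FCc Z → AxisCell Z)
    (hP : ∀ P ∈ C.upper, FCc P → AxisCell P)
    (hw : ∀ Z, (Z ∈ C.lower ∨ Z ∈ C.upper) → FCc Z → pwt Z.pat = 0 ∨ pwt Z.pat = 4)
    (hA : ClassScreen (C.wch mN mP)) (hμ : C.wch mN mP eWord ≠ 0) : False := by
  have key : ∀ κ : Fin 16, C.HasFC κ → pwt κ = 0 ∨ pwt κ = 4 := fun κ ⟨Z, hZ, hfc, hp⟩ => hp ▸ hw Z hZ hfc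
  obtain ⟨-, -, h3, -, h7, -⟩ := pwt_table
  rcases C.parity_weights_of_classScreen mN mP hN hP hA hμ with ⟨-, h, -⟩ | ⟨-, h⟩
  · have := key 3 h; omega
  · have := key 7 h; omega

/-! ## §3 Orbit forms: Δ² preserves pattern and signed charge (≥ 16 FC classes on a Δ²-closed support); Δ complements the pattern -/

/-- negating `β` keeps the pattern bit and negates the signed charge. -/
theorem kbit_chargeOf_neg (x : BPoint) :
    kbit ((x.1, -x.2.1, -x.2.2) : BPoint) = kbit x ∧ chargeOf ((x.1, -x.2.1, -x.2.2) : BPoint) = -chargeOf x :=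
  ⟨by simp [kbit], by simp [chargeOf]; ring⟩

/-- **Δ² PRESERVES THE PARITY PATTERN** (RESULT 15 (3)). -/
theorem MCell.pat_delta2 (Z : MCell) : Z.delta2.pat = Z.pat := by
  apply Fin.ext
  simp only [MCell.pat, MCell.delta2_apply, kbit_chargeOf_neg]

/-- **Δ² PRESERVES THE SIGNED CHARGE PRODUCT** (four sign flips: RESULT 15 (3) «AND the antipodal sign ((−1)^{#k≥2} ↦ (−1)^{4−#} = same)» —
no cancellation inside a Δ²-orbit). -/
theorem MCell.cprod_delta2 (Z : MCell) : Z.delta2.cprod = Z.cprod := by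
  simp only [MCell.cprod, MCell.delta2_apply, kbit_chargeOf_neg]
  ring

/-- Δ² preserves full charge, and axis-ness. -/
theorem MCell.fcc_axis_delta2 (Z : MCell) : (FCc Z.delta2 ↔ FCc Z) ∧ (AxisCell Z.delta2 ↔ AxisCell Z) := by
  constructor
  · simp only [FCc, MCell.delta2_apply, ne_eq, Prod.ext_iff, neg_eq_zero]
  · simp only [AxisCell, AxisPt, MCell.delta2_apply, ne_eq, neg_eq_zero]

/-- a fully charged class is moved by Δ² (`β ↦ −β ≠ β`). -/
theorem MCell.delta2_ne_self (Z : MCell) (hZ : FCc Z) : Z.delta2 ≠ Z := by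
  intro h
  have h0 := congrFun h 0
  rw [MCell.delta2_apply] at h0
  apply hZ 0
  have e1 : (Z 0).2.1 = 0 := by have := congrArg (fun p : BPoint => p.2.1) h0; simp at this; omega
  have e2 : (Z 0).2.2 = 0 := by have := congrArg (fun p : BPoint => p.2.2) h0; simp at this; omega
  exact Prod.ext e1 e2

/-- **≥ 16 FULLY CHARGED CLASSES ON A Δ²-CLOSED SUPPORT** (RESULT 15 (3): «⟨Δ²⟩-invariant (H1) designs need ≥ 8 FC Δ²-orbits (≥ 16 FC classes)
in all 8 even (Re μ ≠ 0) or all 8 odd (Im μ ≠ 0) parity patterns»; here the class-level form, which needs only the SUPPORT to be Δ²-closed):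
(A1) + μ ≠ 0 ⇒ for each of eight parity patterns (all even-weight or all odd-weight) a present FC class `Z` of that pattern whose antipode
`Δ²Z ≠ Z` is present, FC, and of the SAME pattern. -/
theorem MConfig.sixteen_fc_of_d2Closed (C : MConfig) (hl : D2Closed C.lower) (hu : D2Closed C.upper) (mN mP : MCell → ℤ)
    (hN : ∀ Z ∈ C.lower, FCc Z → AxisCell Z) (hP : ∀ P ∈ C.upper, FCc P → AxisCell P) (hA : ClassScreen (C.wch mN mP))
    (hμ : C.wch mN mP eWord ≠ 0) :
    let Pair : Fin 16 → Prop := fun κ => ∃ Z, (Z ∈ C.lower ∨ Z ∈ C.upper) ∧ FCc Z ∧ Z.pat = κ ∧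
      (Z.delta2 ∈ C.lower ∨ Z.delta2 ∈ C.upper) ∧ FCc Z.delta2 ∧ Z.delta2.pat = κ ∧ Z.delta2 ≠ Z
    (Pair 0 ∧ Pair 3 ∧ Pair 5 ∧ Pair 6 ∧ Pair 9 ∧ Pair 10 ∧ Pair 12 ∧ Pair 15) ∨
      (Pair 1 ∧ Pair 2 ∧ Pair 4 ∧ Pair 7 ∧ Pair 8 ∧ Pair 11 ∧ Pair 13 ∧ Pair 14) := by
  intro Pair
  have lift : ∀ κ : Fin 16, (C.xPat mN mP κ : ℚ) ≠ 0 → Pair κ := fun κ h => by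
    obtain ⟨Z, hZ, hfc, hp⟩ := C.exists_of_xPat_ne mN mP κ h
    refine ⟨Z, hZ, hfc, hp, ?_, (Z.fcc_axis_delta2.1).2 hfc, (Z.pat_delta2).trans hp, Z.delta2_ne_self hfc⟩
    rcases hZ with hZ | hZ
    · exact Or.inl (hl Z hZ)
    · exact Or.inr (hu Z hZ)
  rcases C.eight_parity_patterns_of_classScreen' mN mP hN hP hA hμ with ⟨h0, h3, h5, h6, h9, h10, h12, h15⟩ | ⟨h1, h2, h4, h7, h8, h11, h13, h14⟩
  · exact Or.inl ⟨lift 0 h0, lift 3 h3, lift 5 h5, lift 6 h6, lift 9 h9, lift 10 h10, lift 12 h12, lift 15 h15⟩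
  · exact Or.inr ⟨lift 1 h1, lift 2 h2, lift 4 h4, lift 7 h7, lift 8 h8, lift 11 h11, lift 13 h13, lift 14 h14⟩

/-- Δ (`β ↦ iβ`) FLIPS the pattern bit of an axis letter. -/
theorem kbit_deltaPt (x : BPoint) (hx : AxisPt x) : kbit (deltaPt x) = 1 - kbit x := by
  rcases hx with ⟨h1, h2⟩ | ⟨h1, h2⟩ <;> simp [kbit, deltaPt, h1, h2]

/-- Δ negates the signed charge exactly on the REAL-phase letters (bit `0`), keeps it on the imaginary-phase ones. -/
theorem chargeOf_deltaPt (x : BPoint) (hx : AxisPt x) :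
    chargeOf (deltaPt x) = (if kbit x = 0 then -1 else 1) * chargeOf x := by
  rcases hx with ⟨h1, h2⟩ | ⟨h1, h2⟩ <;> simp [kbit, chargeOf, deltaPt, h1, h2]

/-- **Δ COMPLEMENTS THE PARITY PATTERN** (card W14 ∕ RESULT 10: «Δ maps a parity pattern ρ to its complement»): every bit flips. -/
theorem MCell.bitOf_pat_delta (Z : MCell) (hZ : AxisCell Z) (f : Fin 4) : bitOf Z.delta.pat f = 1 - bitOf Z.pat f := by
  rw [bitOf_pat, bitOf_pat]
  exact kbit_deltaPt (Z f) (hZ f)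

/-- **Δ's ORBIT-INTRINSIC SIGN** (RESULT 10: «s₀ ↦ s₀·(−1)^{w(ρ)}», up to the global `(−1)⁴`): the signed charge product picks up a factor `−1`
for every REAL-phase factor, i.e. `(−1)^{4 − |ρ|} = (−1)^{|ρ|}`. -/
theorem MCell.cprod_delta (Z : MCell) (hZ : AxisCell Z) :
    Z.delta.cprod = ((if kbit (Z 0) = 0 then -1 else 1) * (if kbit (Z 1) = 0 then -1 else 1) *
      (if kbit (Z 2) = 0 then -1 else 1) * (if kbit (Z 3) = 0 then -1 else 1)) * Z.cprod := by
  simp only [MCell.cprod, MCell.delta, chargeOf_deltaPt _ (hZ _)]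
  ring

/-- a factor permutation permutes the pattern's bits and FIXES the signed charge product (S₄ preserves the parity weight). -/
theorem MCell.kbit_cprod_perm (σ : Equiv.Perm (Fin 4)) (Z : MCell) :
    (∀ f, bitOf (Z.perm σ).pat f = bitOf Z.pat (σ f)) ∧ (Z.perm σ).cprod = Z.cprod := by
  refine ⟨fun f => by rw [bitOf_pat, bitOf_pat, MCell.perm_apply], ?_⟩
  have e : ∀ W : MCell, W.cprod = ∏ f, chargeOf (W f) := fun W => by simp [MCell.cprod, Fin.prod_univ_four]
  rw [e, e]
  exact Equiv.prod_comp σ (fun f => chargeOf (Z f))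

/-! ## §4 Kernel probes -/

/-- the four-phase cell `fcCell = [ℓ₁|ℓ₋ᵢ|ℓ₋₁|ℓ_i]`: an axis cell OUTSIDE the two-phase window; parity pattern `0101₂ = 5` (weight 2);
signed charge product `(+1)(+1)(−1)(−1) = 1`; the parity-form sentence at `s = 0` (`ēēēē`), `s = 5`, `s = 9`; Δ² keeps pattern and `C±`,
Δ sends the pattern to its complement `1010₂ = 10`. [kernel, `decide`] -/
theorem parity_probe :
    AxisCell fcCell ∧ ¬ WinCell fcCell ∧ fcCell.pat = 5 ∧ pwt 5 = 2 ∧ fcCell.cprod = 1 ∧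
      fcCell.ch (sWord 0) = (fcCell.cprod : GaussianInt) * unitI ^ expKS 5 0 ∧
      fcCell.ch (sWord 5) = (fcCell.cprod : GaussianInt) * unitI ^ expKS 5 5 ∧
      fcCell.ch (sWord 9) = (fcCell.cprod : GaussianInt) * unitI ^ expKS 5 9 ∧
      fcCell.delta2.pat = 5 ∧ fcCell.delta2.cprod = 1 ∧ fcCell.delta.pat = 10 ∧ fcCell.delta.cprod = fcCell.cprod := by
  decide +kernel

end Summit.Ventures.HSemireg.Pad4Tower
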